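import Summits.ABC.ABC.Theses.PadicPrimesKummerThird
import Summits.ABC.StewartYu.KummerThirdDoor
import Literature.NumberTheory.DiophantineGeometry.AbcStewartYu2001MaxFormProofs

set_option linter.dupNamespace false

/-!
# A1.M3c (corollary record): the two Gen-3 `p`-adic cruxes `Y07Odd ∧ Y07Two` ALONE give the
# largest-prime-factor / Vojta max-form of Stewart–Yu 2001, Theorem 2

`Summits/ABC/ABC/Theorems/StewartYu2001MaxFormOfKummerThird.lean` — cell `abc-stewartyu` (HOME
`run/shared/lean/pub/abc-stewartyu/`), route `PadicPrimesKummerThird` (route-ABC-PadicPrimesKummerThird),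
filed `--supports stmt-ABC-19658` by seat p4 (g3) from planner g7's staged file (HOME/plan/m3/staged/,
farm rc 0, 2026-08-26T20:0xZ; director-abc ruling N5(b) 2026-08-26T20:13:16Z: «by-product edge of A1.M3,
corollary-in-waiting»).

The A1.M3 cruxes (`Y07Odd`, `Y07Two` of `Summits/ABC/ABC/Theses/PadicPrimesKummerThird.lean`) alone — no
archimedean input, no Kummer theory — give the member-`z` («`P(z)`») / Vojta max-form of Stewart–Yu 2001
Thm 2: `log c < P(c) · rad(abc)^{C / log log log rad*}`-shape with `P(c)` the largest prime factor of `c`,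
via p3's place bound `Summit.ABC.StewartYu.KummerThird.placeBound_c_of_y07At` and lit-abc-sy2001's
`Literature.NumberTheory.DiophantineGeometry.StewartYu2001.log_lt_largestPrimeFactor_mul_of_padicPlaceBound`
(p464976).  One theorem, no definitions, no named fact.

References: C. L. Stewart, K. Yu, *On the abc conjecture II*, Duke Math. J. 108 (2001), Thm 2;
K. Yu, *p-adic logarithmic forms and group varieties III*, Forum Math. 19 (2007).
-/

namespace Summit.ABC.ABC.Theorems

open Summit.ABC.ABC.Theses.PadicPrimesKummerThird
open Literature.NumberTheory.DiophantineGeometry Literature.Barriers.ABC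

/-- **A1.M3c**: the Gen-3 `p`-adic cruxes `Y07Odd` (odd `p`) and `Y07Two` (`p = 2`) alone imply the
largest-prime-factor form of Stewart–Yu 2001 Thm 2: there is `C > 0` with
`log c < P(c) · rad(abc)^{thm2Exponent C (rad abc)}` for every `abc`-triple with `2 < c`, `P(c)` the largest
prime factor of `c`. [cite: StewartYu2001, Thm 2 (max-form); Yu2007, Main Thm (K = ℚ)] -/
theorem stewartYu2001_largestPrimeFactorForm_of_y07 (h₁ : Y07Odd) (h₂ : Y07Two) :
    ∃ C : ℝ, 0 < C ∧ ∀ a b c : ℕ, IsABCTriple a b c → 2 < c →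
      Real.log c < largestPrimeFactor c * (rad a b c : ℝ) ^ StewartYu2001.thm2Exponent C (rad a b c) := by
  obtain ⟨C, hC0, hY⟩ := Summit.ABC.StewartYu.KummerThird.y07At_of_odd_two h₁ h₂
  have hK : (1 : ℝ) ≤ max 4 C := le_trans (by norm_num) (le_max_left _ _)
  exact StewartYu2001.log_lt_largestPrimeFactor_mul_of_padicPlaceBound hK
    (fun h h1 p hp hpc => Summit.ABC.StewartYu.KummerThird.placeBound_c_of_y07At hC0 h h1 hp (hY p hp) hpc)

end Summit.ABC.ABC.Theorems
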